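import Summits.QuantumFields.YangMills.Theorems.FluctuationComparisonRegPrIntLS2BetaChartContWindowChart
import Summits.QuantumFields.YangMills.Theorems.FluctuationComparisonRegPrIntLS2BetaChartContDescendJoint
import HarnessLib

/-!
# CHART∞ · V-c2ʲ (LINE g18-1 `semiclassical_s2beta`, LAPLACE row): THE WINDOW CHART OF RECORD — JOINT continuity edition
Cell `ym3-torus` (rung R3: `SU(2)` Yang–Mills on `T³` — NOT `d = 4`, NOT infinite volume, NOT a mass gap, NOT Clay); width seat `ym-ust-20520-w3` g16; helper of
`stmt-QuantumFields-20520` (`--supports`, NOT a proof of it); THEOREMS ONLY (0 `def`, default heartbeats).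
★ `exists_windowChart_cont_joint` = ✓V-c2 `exists_windowChart_cont` (same regime, same chart of record via ✓`exists_windowChart_of_carrierData`, same 14 clauses,
proof re-run verbatim on ✓V-c1ʲ `exists_chartData_descendTo_carrier_joint`) PLUS the clause **`ContinuousOn (fun q => c.Φ q) {q | c.jac q ≠ 0} ∧
ContinuousOn (fun q => c.jac q) {q | c.jac q ≠ 0}`** — JOINT continuity of the chart of record and its Jacobian on the live graph (asked by w4-20520 g16 v11.2 (3)
(j1)-WITHIN and w5-20520 g14 C2″-WITHIN).  HONEST: re-threading, no new estimate; LAPLACE ∕ S2β ∕ crux 20520 ∕ `YM3TorusSU2` ∕ Clay NOT proved.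
[cite: Balaban1987RG1, (0.4) p.253, (2.4) p.266 and (2.10) p.267] [cite: Balaban1985UV3, (7) p.257]
-/

noncomputable section

open MeasureTheory Filter Topology Set
open scoped ENNReal NNReal
open Literature.MathematicalPhysics.QuantumFieldTheory.Balaban1983to89 T3ContinuumYM3Torus T3UnitLawDensityEML T3UnitScaleTilt T3TiltDescent T3LevelShift
  T3Thresholds T4Continuum
open scoped Literature.MathematicalPhysics.QuantumFieldTheory.Balaban1983to89.T3OrbitAverage

namespace Summit.QuantumFields.YangMills.Theorems.FluctuationComparisonRegPrIntLS2BetaChartContWindowChartJoint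

open Summit.QuantumFields.YangMills.Theorems FluctuationComparisonRegPrIntLWregChain FluctuationComparisonRegPrIntLWregFibredChart
  FluctuationComparisonRegPrIntLWregGlue FluctuationComparisonRegPrIntLWregInterior FluctuationComparisonRegPrIntLWregAssembly
  FluctuationComparisonRegPrIntLS2BetaChartContDescend FluctuationComparisonRegPrIntLS2BetaChartContClosedProfile
  FluctuationComparisonRegPrIntLS2BetaChartContWindowChart FluctuationComparisonRegPrIntLS2BetaChartContDescendJoint
open Function
open Literature.MathematicalPhysics.QuantumFieldTheory.Balaban1983to89.BlockAveraging (Idx loopHol)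
open Literature.MathematicalPhysics.QuantumFieldTheory.Balaban1983to89.BlockAveragingEMLHaarAC (offCard)
open Literature.MathematicalPhysics.QuantumFieldTheory.Balaban1983to89.ExpMeanLog (deltaSU)
open Literature.MathematicalPhysics.QuantumFieldTheory.Balaban1983to89.LatticeWordStokes (dist1_loopHol_le)

/-- ★ **THE WINDOW CHART OF RECORD WITH ITS CARRIER ROWS AND JOINT CONTINUITY ON THE LIVE GRAPH, HYPOTHESIS-FREE** (= ✓`exists_windowChart_cont` ⊕
`ContinuousOn (fun q => c.Φ q) {q | c.jac q ≠ 0} ∧ ContinuousOn (fun q => c.jac q) {q | c.jac q ≠ 0}`).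
[cite: Balaban1987RG1, (0.4) p.253, (2.4) p.266 and (2.10) p.267] [cite: Balaban1985UV3, (7) p.257] -/
theorem exists_windowChart_cont_joint :
    ∀ (L : ℕ) (b₀ p₀ : ℝ), 0 < b₀ → 0 < p₀ → ∃ γ₁ : ℝ, 0 < γ₁ ∧ ∀ (F : T3Family) (γ : ℝ), F.L = L → 0 < γ → γ ≤ γ₁ →
      ∀ (J K : ℕ) (hJK : J ≤ K),
        ∃ (c : WindowChart F hJK (histGood F ℰp (θBal F.L γ b₀ p₀) K J) {V | PlaqSmall (θBal F.L γ b₀ p₀ J) V})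
          (T : PBond (F.P K) (K - J) → GaugeField (F.P K) 0 (Matrix.specialUnitaryGroup (Fin 2) ℂ) → Set (Matrix.specialUnitaryGroup (Fin 2) ℂ))
          (w : PBond (F.P K) (K - J) → PBond (F.P J) 0),
          (∀ V z, c.jac (V, z) ≠ 0 → descendTo F ℰp J K hJK (c.Φ (V, z)) = V) ∧
          (∀ V z, c.jac (V, z) ≠ 0 ↔ (∀ c', V (w c') ∈ T c' z) ∧ c.Φ (V, z) ∈ closure (histGood F ℰp (θBal F.L γ b₀ p₀) K J)) ∧
          (∀ V, IsCompact {z | c.jac (V, z) ≠ 0}) ∧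
          (∀ V, ContinuousOn (fun z => c.Φ (V, z)) {z | c.jac (V, z) ≠ 0} ∧ ContinuousOn (fun z => c.jac (V, z)) {z | c.jac (V, z) ≠ 0}) ∧
          (∀ c' z (g : PBond (F.P K) (K - J) → Matrix.specialUnitaryGroup (Fin 2) ℂ), T c' (Function.extend (iterCentralBond (K - J)) g z) = T c' z) ∧
          (∀ V z (g : PBond (F.P K) (K - J) → Matrix.specialUnitaryGroup (Fin 2) ℂ), c.jac (V, Function.extend (iterCentralBond (K - J)) g z) = c.jac (V, z)) ∧
          (∀ V z (g : PBond (F.P K) (K - J) → Matrix.specialUnitaryGroup (Fin 2) ℂ), c.jac (V, z) ≠ 0 →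
            c.Φ (V, Function.extend (iterCentralBond (K - J)) g z) = c.Φ (V, z)) ∧
          (∀ V U, descendTo F ℰp J K hJK U = V → U ∈ closure (histGood F ℰp (θBal F.L γ b₀ p₀) K J) → c.jac (V, U) ≠ 0 ∧ c.Φ (V, U) = U) ∧
          (∀ V z, (∀ c', V (w c') ∈ T c' z) → (∀ b, (∀ c', iterCentralBond (K - J) c' ≠ b) → c.Φ (V, z) b = z b) ∧
            descendTo F ℰp J K hJK (c.Φ (V, z)) = V) ∧
          (∀ (u : GaugeTransf (F.P K) 0 (Matrix.specialUnitaryGroup (Fin 2) ℂ)),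
            (∀ V' : GaugeField (F.P K) (K - J) (Matrix.specialUnitaryGroup (Fin 2) ℂ), GaugeField.gaugeAct (transfUp u (K - J)) V' = V') →
            ∀ V z, c.jac (V, GaugeField.gaugeAct u z) = c.jac (V, z) ∧
              (c.jac (V, z) ≠ 0 → c.Φ (V, GaugeField.gaugeAct u z) = GaugeField.gaugeAct u (c.Φ (V, z)))) ∧
          (∀ V U, descendTo F ℰp J K hJK U = V → U ∈ histGood F ℰp (θBal F.L γ b₀ p₀) K J → {z | c.jac (V, z) ≠ 0} ∈ 𝓝 U) ∧
          (∀ V z U', U' ∈ closure (histGood F ℰp (θBal F.L γ b₀ p₀) K J) → descendTo F ℰp J K hJK U' = V →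
            (∀ b, (∀ c', iterCentralBond (K - J) c' ≠ b) → U' b = z b) → c.jac (V, z) ≠ 0 ∧ c.Φ (V, z) = U') ∧
          (ContinuousOn (fun q => c.Φ q) {q | c.jac q ≠ 0} ∧ ContinuousOn (fun q => c.jac q) {q | c.jac q ≠ 0}) := by
  intro L b₀ p₀ hb hp
  by_cases hL : 1 ≤ L
  swap
  · refine ⟨1, one_pos, fun F γ hFL _ _ => ?_⟩
    exact absurd (hFL ▸ F.hL.2.le) hL
  obtain ⟨α, hα0, hα24, hα64, hαF⟩ := exists_chartRegime L hL
  set D₅ : ℝ := ((((3 + 2) * L : ℕ) : ℝ) ^ 2 / 4) with hD₅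
  have hD₅0 : 0 ≤ D₅ := by positivity
  set σ : ℝ := α / (D₅ + 1) with hσ
  have hσ0 : 0 < σ := div_pos hα0 (by positivity)
  set δ₀ : ℝ := α / (D₅ + 1 / 2) with hδ₀def
  have hδ₀0 : 0 < δ₀ := div_pos hα0 (by positivity)
  have hσδ : σ < δ₀ := by
    rw [hσ, hδ₀def]
    exact div_lt_div_of_pos_left hα0 (by positivity) (by linarith)
  have hDδ : D₅ * δ₀ < α := by
    rw [hδ₀def, mul_div_assoc', div_lt_iff₀ (by positivity)]
    nlinarith [hα0]
  obtain ⟨γ₂, hγ₂, hγ₂1, hθσ⟩ := exists_gamma_forall_θBal_le (b₀ := b₀) (p₀ := p₀) hb hp hσ0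
  refine ⟨γ₂, hγ₂, fun F γ hFL hγ hγle J K hJK => ?_⟩
  haveI : BorelSpace (GaugeField (F.P K) 0 (Matrix.specialUnitaryGroup (Fin 2) ℂ)) :=
    inferInstanceAs (BorelSpace (PBond (F.P K) 0 → Matrix.specialUnitaryGroup (Fin 2) ℂ))
  have hLF : 1 ≤ F.L := F.hL.2.le
  obtain ⟨hαL, hgap⟩ := hαF F hFL K
  have hγ1 : γ ≤ 1 := hγle.trans hγ₂1
  have hθpos : ∀ i, 0 < θBal F.L γ b₀ p₀ i := fun i => T3MinimiserStabilityReduction.θBal_pos hLF hγ hγ1 hb p₀ i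
  have hd : (F.P K).d = 3 := T3Family.P_d F K
  have hLL : (F.P K).L = L := hFL
  have hD₅eq : (((((F.P K).d + 2) * (F.P K).L : ℕ) : ℝ) ^ 2 / 4) = D₅ := by rw [hd, hLL]
  have hθδ : ∀ i, θBal F.L γ b₀ p₀ i < δ₀ := fun i => (hθσ F.L hLF γ hγ hγle i).trans_lt hσδ
  have hsmall : (((((F.P K).d + 2) * (F.P K).L : ℕ) : ℝ) ^ 2 / 4) * δ₀ ≤ ExpMeanLog.deltaSU (Fin 2) / 2 := by
    rw [hD₅eq]; nlinarith [hDδ, hα64, ExpMeanLog.deltaSU_pos (n := Fin 2)]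
  have hD : (((((F.P K).d + 2) * (F.P K).L : ℕ) : ℝ) ^ 2 / 4) * δ₀ < α := by rw [hD₅eq]; exact hDδ
  have hαδ : α < deltaSU (Fin 2) := by nlinarith [ExpMeanLog.deltaSU_pos (n := Fin 2)]
  have hn : K - J ≤ (F.P K).m + (F.P K).K := by
    show K - J ≤ F.m + K
    omega
  have hβ := iterCentralBond_injective (P := F.P K) (n := K - J) hn
  set θ := θBal F.L γ b₀ p₀ with hθdef
  -- CHART-VOL for the Jacobian bound, then the continuous pivot-blind chart (IV-c) and its transport (V-c1)
  obtain ⟨j₀, hj₀, hvol⟩ := Summit.QuantumFields.YangMills.Theorems.FluctuationComparisonRegPrIntLWreg.chartVol F K α hα0 hα24 hα64 hαL hgap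
  obtain ⟨Φ, Jac, T, hΦm, hJm, hfib, hlaw, hTc, hJT, hreg, hdead, hTeq, hcharted, hbdd, hrecog, -, -, -, hTbl, hΦbl, hJbl, htransfer⟩ :=
    Summit.QuantumFields.YangMills.Theorems.FluctuationComparisonRegPrIntLS2BetaChartContBlindFibredChart.exists_fibredChart_iter_cont_blind
      (N := 2) (P := F.P K) hα0.le hα24 hα64 hαL hgap (Or.inr hvol) hn
  have hSm : MeasurableSet (histGood F ℰp θ K J) := measurableSet_histGood F ℰp measurableE_ℰp θ K J
  have hHcl : IsClosed (closure (histGood F ℰp θ K J)) := isClosed_closure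
  -- gauge covariance of the generic chart (V-b1 ∕ V-b2) and gauge invariance of the companion
  have hcovΦ := fun (u : GaugeTransf (F.P K) 0 (Matrix.specialUnitaryGroup (Fin 2) ℂ)) V z (hJ : Jac (V, z) ≠ 0) =>
    Summit.QuantumFields.YangMills.Theorems.FluctuationComparisonRegPrIntLS2BetaChartContCovariance.chart_gaugeAct
      (N := 2) (P := F.P K) hn hfib hJT hcharted hrecog u V z hJ
  have hcovJ := fun (u : GaugeTransf (F.P K) 0 (Matrix.specialUnitaryGroup (Fin 2) ℂ)) V z (hJ : Jac (V, z) ≠ 0) hstrict =>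
    Summit.QuantumFields.YangMills.Theorems.FluctuationComparisonRegPrIntLS2BetaChartContCovariancePointwise.jac_gaugeAct_eq_of_live
      (N := 2) (P := F.P K) hαδ hn hΦm hJm hfib hlaw hJT hcharted hrecog htransfer hTbl hΦbl hJbl u V z hJ hstrict
  have hHg : ∀ (u : GaugeTransf (F.P K) 0 (Matrix.specialUnitaryGroup (Fin 2) ℂ)) U,
      GaugeField.gaugeAct u U ∈ closure (histGood F ℰp θ K J) ↔ U ∈ closure (histGood F ℰp θ K J) := by
    have key : ∀ (v : GaugeTransf (F.P K) 0 (Matrix.specialUnitaryGroup (Fin 2) ℂ)) W, W ∈ closure (histGood F ℰp θ K J) →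
        GaugeField.gaugeAct v W ∈ closure (histGood F ℰp θ K J) := fun v W hW =>
      map_mem_closure (Summit.QuantumFields.YangMills.Theorems.FluctuationComparisonRegPrIntLS2BetaChartContCovariancePointwise.continuous_gaugeAct v)
        hW fun x hx => (Summit.QuantumFields.YangMills.Theorems.FluctuationComparisonRegPrIntLS2BetaResidualGauge.gaugeAct_mem_histGood_iff F v θ J x).2 hx
    intro u U
    refine ⟨fun h => ?_, key u U⟩
    have h' := key (fun x => (u x)⁻¹) _ h
    rwa [Summit.QuantumFields.YangMills.Theorems.FluctuationComparisonRegPrIntLS2BetaChartContCovariance.gaugeAct_inv_gaugeAct] at h'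
  have hgraph := fun (U₀ : GaugeField (F.P K) 0 (Matrix.specialUnitaryGroup (Fin 2) ℂ)) hstrict =>
    Summit.QuantumFields.YangMills.Theorems.FluctuationComparisonRegPrIntLS2BetaChartContCarrierNhds.graph_mem_nhds (N := 2) (P := F.P K)
      hα24 hαδ hαL hn hJT hrecog U₀ hstrict
  have hSo : IsOpen (histGood F ℰp θ K J) := isOpen_histGood F hδ₀0.le (fun i => (hθδ i).le) hsmall hJK
  obtain ⟨Φ', jac, w, hΦ'm, hjm, hfib', -, hlaw', hTc', hne, hcont, hdead', hTeq', hcharted', hbdd', hrecog', hcompact, hcontOn, hTbl', hjbl, hΦbl',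
      hself, hcov, hnhds, hjoint⟩ :=
    exists_chartData_descendTo_carrier_joint (N := 2) F hJK hαδ hΦm hJm hfib hlaw hTc hJT hreg hdead hTeq hcharted hbdd hrecog htransfer hTbl hΦbl hJbl
      hcovΦ hcovJ hgraph hSm hHcl.measurableSet subset_closure (closure_histGood_subset_charted F hJK hδ₀0.le hθδ hsmall hD) hHcl
      (closure_histGood_subset_loopSmall_lt F hJK hδ₀0.le hθδ hsmall hD) hHg hSo
  -- the window chart of record (§3)
  have hq : j₀ ^ ((K - J) * Fintype.card (PBond (F.P K) (K - J))) ≠ 0 := pow_ne_zero _ hj₀.ne'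
  have hbddinv : ∀ p, jac p ≤ (j₀ ^ ((K - J) * Fintype.card (PBond (F.P K) (K - J))))⁻¹ := fun p => by
    rw [NNReal.le_inv_iff_mul_le hq, mul_comm]
    exact hbdd' p
  obtain ⟨c, hcΦ, hcjac⟩ := exists_windowChart_of_carrierData F hJK hθpos hδ₀0.le hθδ hsmall hD hα0 hα24 hα64 hαL hgap hΦ'm hjm hfib' hlaw' hne
    hcont hdead' hTc' hTeq' hcharted' hbddinv hrecog'
  -- recognition of ANY closed-profile fibre field with the off-pivot coordinates of `z` (α-free form)
  have hrecogF : ∀ V z U', U' ∈ closure (histGood F ℰp θ K J) → descendTo F ℰp J K hJK U' = V →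
      (∀ b, (∀ c', iterCentralBond (K - J) c' ≠ b) → U' b = z b) → jac (V, z) ≠ 0 ∧ Φ' (V, z) = U' := by
    intro V z U' hU' hd hoff
    have hext : Function.extend (iterCentralBond (K - J)) (fun c' => U' (iterCentralBond (K - J) c')) z = U' := by
      funext b
      by_cases hb : ∃ c', iterCentralBond (K - J) c' = b
      · obtain ⟨c', rfl⟩ := hb
        exact hβ.extend_apply _ _ _
      · rw [Function.extend_apply' _ _ _ hb]
        exact (hoff b fun c' hc => hb ⟨c', hc⟩).symm
    have hg : ∀ c', U' (iterCentralBond (K - J) c') ∈ chainWindow (N := 2) α (K - J) z c' := fun c' => by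
      have h := closure_histGood_subset_charted F hJK hδ₀0.le hθδ hsmall hD hU' c'
      rwa [← hext, hβ.extend_apply, chainWindow_extend α hn] at h
    have h := hrecog' V z (fun c' => U' (iterCentralBond (K - J) c')) hg (by rw [hext]; exact hU') (by rw [hext]; exact hd)
    rw [hext] at h
    exact h
  refine ⟨c, T, w, ?_, ?_, ?_, ?_, hTbl', ?_, ?_, ?_, ?_, ?_, ?_, ?_, ?_⟩ <;> simp only [hcΦ, hcjac]
  · exact hfib'
  · exact hne
  · exact hcompact
  · exact hcontOn
  · exact hjbl
  · exact hΦbl'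
  · exact hself
  · exact fun V z hV => ⟨(hcharted' V z hV).1, (hcharted' V z hV).2.2⟩
  · exact hcov
  · exact hnhds
  · exact hrecogF
  · exact hjoint

end Summit.QuantumFields.YangMills.Theorems.FluctuationComparisonRegPrIntLS2BetaChartContWindowChartJoint

end
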